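import Mathlib
import Summits.MatrixMultiplication.MatrixMultiplication.Theorems.GradedDesignFamily.Negative.SubfieldCellLineReps

/-!
# Fixed line representatives of `2 × 2` matrices over a finite field, and trace-`±2` elements of
# `SL₂(k)` (crux `LevelGradedCohnUmans.GradedDesignFamily`, stmt-MatrixMultiplication-7610;
# negative side, line `quadratic-extension-level-one-cell`, stub S3 `stub_subfieldCell`)

HONEST FRAMING.  Support for a THEOREM about the finite cells of S3 (the sharp uniform counting
wall for EVERY injective `φ`, file `SubfieldCellUniformWallSharpAll`); a verdict / certificate
tool, not summit progress.

* `fixCount M` = the number of line representatives `ℓ ∈ LR` with `M ℓ ∈ Kˣ·ℓ` (= fixed points of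
  `M` on `P¹(K)`); `fixCount_one = |K| + 1`, `fixCount_le`, `fixCount_le_sq` (a line fixed by `M`
  is fixed by `M²`), and the key `fixCount_le_one`: if `M ^ |K| = 1` and `M ≠ 1` then `M` fixes AT
  MOST ONE line (an eigenvalue `c` has `c = c ^ |K| = 1`, and fixing two representatives pointwise
  forces `M = 1`, `eq_one_of_fix_two`).
* `lineRep_count_smul`: for `A ∈ GL₂(K)` and `w₀ ≠ 0` exactly one `ℓ ∈ LR` has `A ℓ ∈ Kˣ·w₀`.
* `SL₂(k)`: `nilSq_of_trace` (`tr t = 2r`, `r² = 1` ⇒ `(t − r)² = 0`), `pow_card_eq_one_of_trace_two`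
  (`tr t = 2 ⇒ t ^ |k| = 1`), `trace_mul_self` (`tr t² = (tr t)² − 2`), `mul_self_ne_one_of_trace_neg_two`
  (`tr t = −2`, `2 ≠ 0`, `t ≠ −1` ⇒ `t² ≠ 1`), `card_filter_trace_le` (`#{t : tr t = 2r} ≤ |k|²` for
  `r² = 1`, by an explicit injection into `k × k`).

Sorry-free; axioms `propext`, `Classical.choice`, `Quot.sound`.
-/

set_option linter.dupNamespace false

open scoped BigOperators
open Matrix

namespace Summit.MatrixMultiplication.MatrixMultiplication.Theorems.GradedDesignFamily.Negative

section GLPart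

variable {K : Type} [Field K] [Fintype K] [DecidableEq K]

/-- The line representatives have exactly `|K| + 1` elements. [folklore] -/
theorem lineReps_card :
    (insert ![0, 1] (Finset.univ.image fun x : K => ![1, x])).card = Fintype.card K + 1 := by
  rw [Finset.card_insert_of_notMem, Finset.card_image_of_injective _ fun x y h => by
    simpa using congrFun h 1, Finset.card_univ]
  simp only [Finset.mem_image, Finset.mem_univ, true_and, not_exists]
  intro x h
  simpa using congrFun h 0

/-- Line representatives are non-zero. -/
theorem lineRep_ne_zero {ℓ : Fin 2 → K}
    (h : ℓ ∈ insert ![0, 1] (Finset.univ.image fun x : K => ![1, x])) : ℓ ≠ 0 := by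
  simp only [Finset.mem_insert, Finset.mem_image, Finset.mem_univ, true_and] at h
  rcases h with rfl | ⟨x, rfl⟩
  · intro h; simpa using congrFun h 1
  · intro h; simpa using congrFun h 0

/-- A matrix fixing two distinct line representatives pointwise is the identity. [folklore] -/
theorem eq_one_of_fix_two {M : Matrix (Fin 2) (Fin 2) K} {ℓ₁ ℓ₂ : Fin 2 → K}
    (h₁ : ℓ₁ ∈ insert ![0, 1] (Finset.univ.image fun x : K => ![1, x]))
    (h₂ : ℓ₂ ∈ insert ![0, 1] (Finset.univ.image fun x : K => ![1, x]))
    (hne : ℓ₁ ≠ ℓ₂) (e₁ : M *ᵥ ℓ₁ = ℓ₁) (e₂ : M *ᵥ ℓ₂ = ℓ₂) : M = 1 := by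
  simp only [Finset.mem_insert, Finset.mem_image, Finset.mem_univ, true_and] at h₁ h₂
  have ev0 : ∀ i, (M *ᵥ ![0, 1]) i = M i 1 := fun i => by
    simp [Matrix.mulVec, dotProduct, Fin.sum_univ_two]
  have ev1 : ∀ (x : K) (i), (M *ᵥ ![1, x]) i = M i 0 + M i 1 * x := fun x i => by
    simp [Matrix.mulVec, dotProduct, Fin.sum_univ_two]
  have fin : M 0 0 = 1 → M 0 1 = 0 → M 1 0 = 0 → M 1 1 = 1 → M = 1 := by
    intro m00 m01 m10 m11
    ext i j
    fin_cases i <;> fin_cases j <;> simp [m00, m01, m10, m11]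
  rcases h₁ with rfl | ⟨x, rfl⟩ <;> rcases h₂ with rfl | ⟨y, rfl⟩
  · exact absurd rfl hne
  · have a0 : M 0 1 = 0 := by have h := congrFun e₁ 0; rw [ev0] at h; simpa using h
    have a1 : M 1 1 = 1 := by have h := congrFun e₁ 1; rw [ev0] at h; simpa using h
    have b0 : M 0 0 + M 0 1 * y = 1 := by have h := congrFun e₂ 0; rwa [ev1] at h
    have b1 : M 1 0 + M 1 1 * y = y := by have h := congrFun e₂ 1; rwa [ev1] at h
    exact fin (by linear_combination b0 - y * a0) a0 (by linear_combination b1 - y * a1) a1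
  · have b0 : M 0 1 = 0 := by have h := congrFun e₂ 0; rw [ev0] at h; simpa using h
    have b1 : M 1 1 = 1 := by have h := congrFun e₂ 1; rw [ev0] at h; simpa using h
    have a0 : M 0 0 + M 0 1 * x = 1 := by have h := congrFun e₁ 0; rwa [ev1] at h
    have a1 : M 1 0 + M 1 1 * x = x := by have h := congrFun e₁ 1; rwa [ev1] at h
    exact fin (by linear_combination a0 - x * b0) b0 (by linear_combination a1 - x * b1) b1
  · have hxy : x - y ≠ 0 := sub_ne_zero.2 fun h => hne (by rw [h])
    have a0 : M 0 0 + M 0 1 * x = 1 := by have h := congrFun e₁ 0; rwa [ev1] at h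
    have a1 : M 1 0 + M 1 1 * x = x := by have h := congrFun e₁ 1; rwa [ev1] at h
    have b0 : M 0 0 + M 0 1 * y = 1 := by have h := congrFun e₂ 0; rwa [ev1] at h
    have b1 : M 1 0 + M 1 1 * y = y := by have h := congrFun e₂ 1; rwa [ev1] at h
    have m01 : M 0 1 = 0 := by
      have h : M 0 1 * (x - y) = 0 := by linear_combination a0 - b0
      exact (mul_eq_zero.1 h).resolve_right hxy
    have m11 : M 1 1 = 1 := by
      have h : (M 1 1 - 1) * (x - y) = 0 := by linear_combination a1 - b1
      exact sub_eq_zero.1 ((mul_eq_zero.1 h).resolve_right hxy)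
    exact fin (by linear_combination a0 - x * m01) m01 (by linear_combination a1 - x * m11) m11

omit [Fintype K] [DecidableEq K] in
/-- Powers act on an eigenvector by powers of the eigenvalue. -/
theorem pow_mulVec_of_eigen (M : Matrix (Fin 2) (Fin 2) K) (w : Fin 2 → K) (c : K)
    (h : M *ᵥ w = c • w) (n : ℕ) : (M ^ n) *ᵥ w = c ^ n • w := by
  induction n with
  | zero => simp
  | succ n ih => rw [pow_succ, ← Matrix.mulVec_mulVec, h, Matrix.mulVec_smul, ih, smul_smul,
      pow_succ']

/-- `fixCount M` = the number of line representatives fixed by `M` as lines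
(= the number of fixed points of `M` on `P¹(K)`). -/
def fixCount (M : Matrix (Fin 2) (Fin 2) K) : ℕ :=
  ((insert ![0, 1] (Finset.univ.image fun x : K => ![1, x])).filter
    fun w => ∃ c : K, c ≠ 0 ∧ M *ᵥ w = c • w).card

/-- Unfolding lemma for `fixCount`. -/
theorem fixCount_def (M : Matrix (Fin 2) (Fin 2) K) : fixCount M =
    ((insert ![0, 1] (Finset.univ.image fun x : K => ![1, x])).filter
      fun w => ∃ c : K, c ≠ 0 ∧ M *ᵥ w = c • w).card := rfl

/-- `fixCount M ≤ |K| + 1`. -/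
theorem fixCount_le (M : Matrix (Fin 2) (Fin 2) K) : fixCount M ≤ Fintype.card K + 1 := by
  rw [fixCount_def, ← lineReps_card (K := K)]
  exact Finset.card_filter_le _ _

/-- The identity fixes every line: `fixCount 1 = |K| + 1`. -/
theorem fixCount_one : fixCount (1 : Matrix (Fin 2) (Fin 2) K) = Fintype.card K + 1 := by
  rw [fixCount_def, ← lineReps_card (K := K), Finset.filter_true_of_mem]
  intro w _
  exact ⟨1, one_ne_zero, by rw [Matrix.one_mulVec, one_smul]⟩

/-- A line fixed by `M` is fixed by `M²`: `fixCount M ≤ fixCount (M * M)`. -/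
theorem fixCount_le_sq (M : Matrix (Fin 2) (Fin 2) K) : fixCount M ≤ fixCount (M * M) := by
  rw [fixCount_def, fixCount_def]
  refine Finset.card_le_card fun w hw => ?_
  rw [Finset.mem_filter] at hw ⊢
  obtain ⟨c, hc, h⟩ := hw.2
  exact ⟨hw.1, c * c, mul_ne_zero hc hc, by rw [← Matrix.mulVec_mulVec, h, Matrix.mulVec_smul, h,
    smul_smul]⟩

/-- **A non-trivial matrix of `p`-power-like order fixes at most one line**: if `M ^ |K| = 1` and
`M ≠ 1` then `fixCount M ≤ 1` (an eigenvalue `c` satisfies `c = c ^ |K| = 1`, and two line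
representatives fixed pointwise force `M = 1`). [folklore] -/
theorem fixCount_le_one (M : Matrix (Fin 2) (Fin 2) K) (hM : M ^ Fintype.card K = 1)
    (hM1 : M ≠ 1) : fixCount M ≤ 1 := by
  rw [fixCount_def]
  refine Finset.card_le_one.2 fun ℓ₁ h₁ ℓ₂ h₂ => ?_
  rw [Finset.mem_filter] at h₁ h₂
  have key : ∀ ℓ ∈ insert ![0, 1] (Finset.univ.image fun x : K => ![1, x]), ∀ c : K,
      M *ᵥ ℓ = c • ℓ → M *ᵥ ℓ = ℓ := by
    intro ℓ hℓ c h
    have hp := pow_mulVec_of_eigen M ℓ c h (Fintype.card K)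
    rw [hM, Matrix.one_mulVec, FiniteField.pow_card] at hp
    have hc : c = 1 := by
      by_contra hc
      apply lineRep_ne_zero hℓ
      have h0 : (c - 1) • ℓ = 0 := by rw [sub_smul, one_smul, ← hp, sub_self]
      exact (smul_eq_zero.1 h0).resolve_left (sub_ne_zero.2 hc)
    rw [h, hc, one_smul]
  obtain ⟨c₁, -, hc₁⟩ := h₁.2
  obtain ⟨c₂, -, hc₂⟩ := h₂.2
  by_contra hne
  exact hM1 (eq_one_of_fix_two h₁.1 h₂.1 hne (key _ h₁.1 _ hc₁) (key _ h₂.1 _ hc₂))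

/-- **Exactly one line representative in each punctured line** `Kˣ·w₀` (`w₀ ≠ 0`), pushed through
any `A ∈ GL₂(K)`: `Σ_{ℓ ∈ LR} [A ℓ ∈ Kˣ·w₀] = 1`. [folklore] -/
theorem lineRep_count_smul (A : Matrix.GeneralLinearGroup (Fin 2) K) {w₀ : Fin 2 → K}
    (hw₀ : w₀ ≠ 0) :
    ∑ ℓ ∈ insert ![0, 1] (Finset.univ.image fun x : K => ![1, x]),
      (if ∃ c : K, c ≠ 0 ∧ (A : Matrix (Fin 2) (Fin 2) K) *ᵥ ℓ = c • w₀ then (1 : ℂ) else 0) =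
        1 := by
  set v : Fin 2 → K := (A⁻¹ : Matrix.GeneralLinearGroup (Fin 2) K).val *ᵥ w₀ with hv_def
  have hv : (A : Matrix (Fin 2) (Fin 2) K) *ᵥ v = w₀ := by
    rw [hv_def, Matrix.mulVec_mulVec, ← Units.val_mul, mul_inv_cancel, Units.val_one,
      Matrix.one_mulVec]
  have hv0 : v ≠ 0 := by
    intro h
    apply hw₀
    rw [← hv, h, Matrix.mulVec_zero]
  have key : ∀ ℓ : Fin 2 → K, (∃ c : K, c ≠ 0 ∧ (A : Matrix (Fin 2) (Fin 2) K) *ᵥ ℓ = c • w₀) ↔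
      ∃ c : K, c ≠ 0 ∧ ℓ = c • v := by
    intro ℓ
    refine exists_congr fun c => and_congr_right fun _ => ?_
    constructor
    · intro h
      have h2 : (A⁻¹ : Matrix.GeneralLinearGroup (Fin 2) K).val *ᵥ
          ((A : Matrix (Fin 2) (Fin 2) K) *ᵥ ℓ) =
          (A⁻¹ : Matrix.GeneralLinearGroup (Fin 2) K).val *ᵥ (c • w₀) := by rw [h]
      rwa [Matrix.mulVec_mulVec, ← Units.val_mul, inv_mul_cancel, Units.val_one,
        Matrix.one_mulVec, Matrix.mulVec_smul] at h2
    · rintro rfl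
      rw [Matrix.mulVec_smul, hv]
  obtain ⟨ℓ₀, hℓ₀, c₀, hc₀⟩ := lineRep_cover v
  have hc₀0 : c₀ ≠ 0 := by
    rintro rfl
    rw [zero_smul] at hc₀
    exact hv0 hc₀
  have hℓ₀v : ℓ₀ = c₀⁻¹ • v := by rw [hc₀, smul_smul, inv_mul_cancel₀ hc₀0, one_smul]
  rw [Finset.sum_eq_single_of_mem ℓ₀ hℓ₀ fun ℓ hℓ hne => ?_, if_pos ((key ℓ₀).2
    ⟨c₀⁻¹, inv_ne_zero hc₀0, hℓ₀v⟩)]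
  rw [if_neg]
  intro hP
  obtain ⟨c, -, hℓc⟩ := (key ℓ).1 hP
  apply hne
  refine (lineRep_eq_of_smul hℓ₀ hℓ (c * c₀) ?_).symm
  rw [hℓc, hc₀, smul_smul]

end GLPart

section SLPart

variable {k : Type} [Field k] [Fintype k] [DecidableEq k]

omit [Fintype k] [DecidableEq k] in
/-- `tr t = 2r`, `r² = 1`, `det t = 1` ⇒ `(t − r)² = 0` (Cayley–Hamilton for `2 × 2`). [folklore] -/
theorem nilSq_of_trace (t : Matrix.SpecialLinearGroup (Fin 2) k) (r : k) (hr : r * r = 1)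
    (htr : Matrix.trace (t : Matrix (Fin 2) (Fin 2) k) = r + r) :
    ((t : Matrix (Fin 2) (Fin 2) k) - r • (1 : Matrix (Fin 2) (Fin 2) k)) *
      ((t : Matrix (Fin 2) (Fin 2) k) - r • (1 : Matrix (Fin 2) (Fin 2) k)) = 0 := by
  have hdet : (t : Matrix (Fin 2) (Fin 2) k) 0 0 * (t : Matrix (Fin 2) (Fin 2) k) 1 1 -
      (t : Matrix (Fin 2) (Fin 2) k) 0 1 * (t : Matrix (Fin 2) (Fin 2) k) 1 0 = 1 := by
    have h := t.2
    rw [Matrix.det_fin_two] at h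
    exact h
  rw [Matrix.trace_fin_two] at htr
  ext i j
  fin_cases i <;> fin_cases j <;>
    simp [Matrix.mul_apply, Fin.sum_univ_two, Matrix.one_apply, Matrix.sub_apply,
      Matrix.smul_apply]
  · linear_combination ((t : Matrix (Fin 2) (Fin 2) k) 0 0) * htr - hdet + hr
  · linear_combination ((t : Matrix (Fin 2) (Fin 2) k) 0 1) * htr
  · linear_combination ((t : Matrix (Fin 2) (Fin 2) k) 1 0) * htr
  · linear_combination ((t : Matrix (Fin 2) (Fin 2) k) 1 1) * htr - hdet + hr

omit [DecidableEq k] in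
/-- **Trace `2` ⇒ `t ^ |k| = 1`** (`t = 1 + N`, `N² = 0`, `(1 + N)^n = 1 + n N`, `|k| = 0` in `k`).
[folklore] -/
theorem pow_card_eq_one_of_trace_two (t : Matrix.SpecialLinearGroup (Fin 2) k)
    (htr : Matrix.trace (t : Matrix (Fin 2) (Fin 2) k) = 2) : t ^ Fintype.card k = 1 := by
  set N : Matrix (Fin 2) (Fin 2) k := (t : Matrix (Fin 2) (Fin 2) k) - 1 with hN_def
  have hN : N * N = 0 := by
    have h := nilSq_of_trace t 1 (mul_one 1) (by rw [htr]; norm_num)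
    rwa [one_smul] at h
  have ht : (t : Matrix (Fin 2) (Fin 2) k) = 1 + N := by rw [hN_def]; abel
  clear_value N
  have hpow : ∀ n : ℕ, (t : Matrix (Fin 2) (Fin 2) k) ^ n = 1 + (n : k) • N := by
    intro n
    induction n with
    | zero => simp
    | succ n ih =>
      rw [pow_succ, ih, ht, add_mul, one_mul, mul_add, mul_one, smul_mul_assoc, hN, smul_zero,
        add_zero, Nat.cast_succ, add_smul, one_smul]
      abel
  apply Subtype.ext
  rw [Matrix.SpecialLinearGroup.coe_pow, hpow, FiniteField.cast_card_eq_zero, zero_smul, add_zero,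
    Matrix.SpecialLinearGroup.coe_one]

omit [Fintype k] [DecidableEq k] in
/-- `tr (t²) = (tr t)² − 2` for `det t = 1`. [folklore] -/
theorem trace_mul_self (t : Matrix.SpecialLinearGroup (Fin 2) k) :
    Matrix.trace ((t * t : Matrix.SpecialLinearGroup (Fin 2) k) : Matrix (Fin 2) (Fin 2) k) =
      Matrix.trace (t : Matrix (Fin 2) (Fin 2) k) * Matrix.trace (t : Matrix (Fin 2) (Fin 2) k)
        - 2 := by
  have hdet : (t : Matrix (Fin 2) (Fin 2) k) 0 0 * (t : Matrix (Fin 2) (Fin 2) k) 1 1 -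
      (t : Matrix (Fin 2) (Fin 2) k) 0 1 * (t : Matrix (Fin 2) (Fin 2) k) 1 0 = 1 := by
    have h := t.2
    rw [Matrix.det_fin_two] at h
    exact h
  rw [Matrix.SpecialLinearGroup.coe_mul, Matrix.trace_fin_two, Matrix.trace_fin_two,
    Matrix.mul_apply, Matrix.mul_apply, Fin.sum_univ_two, Fin.sum_univ_two]
  linear_combination (-2 : k) * hdet

omit [Fintype k] [DecidableEq k] in
/-- `tr t = −2`, `2 ≠ 0`, `t ≠ −1` ⇒ `t² ≠ 1` (`t = −1 + M`, `M² = 0`, `t² = 1 − 2M`). [folklore] -/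
theorem mul_self_ne_one_of_trace_neg_two (t : Matrix.SpecialLinearGroup (Fin 2) k)
    (htr : Matrix.trace (t : Matrix (Fin 2) (Fin 2) k) = -2) (h2 : (2 : k) ≠ 0) (ht : t ≠ -1) :
    t * t ≠ 1 := by
  intro hsq
  set M : Matrix (Fin 2) (Fin 2) k := (t : Matrix (Fin 2) (Fin 2) k) - (-1 : k) • 1 with hM_def
  have hM : M * M = 0 := nilSq_of_trace t (-1) (by ring) (by rw [htr]; ring)
  have ht' : (t : Matrix (Fin 2) (Fin 2) k) = M - 1 := by rw [hM_def, neg_one_smul]; abel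
  clear_value M
  have hsq' : (t : Matrix (Fin 2) (Fin 2) k) * (t : Matrix (Fin 2) (Fin 2) k) = 1 := by
    rw [← Matrix.SpecialLinearGroup.coe_mul, hsq, Matrix.SpecialLinearGroup.coe_one]
  rw [ht', sub_mul, one_mul, mul_sub, mul_one, hM] at hsq'
  -- hsq' : 0 - M - (M - 1) = 1, i.e. `2 • M = 0`
  have h2M : (2 : k) • M = 0 := by
    rw [two_smul]
    have h' : M + M = -(0 - M - (M - 1)) + 1 := by abel
    rw [h', hsq', neg_add_cancel]
  have hM0 : M = 0 := (smul_eq_zero.1 h2M).resolve_left h2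
  apply ht
  apply Subtype.ext
  rw [ht', hM0, zero_sub, Matrix.SpecialLinearGroup.coe_neg, Matrix.SpecialLinearGroup.coe_one]

/-- **At most `|k|²` elements of `SL₂(k)` have trace `2r` when `r² = 1`** (an explicit injection
`t ↦ (t₁₀, 0)` if `t₀₁ = 0`, else `(t₀₀, t₀₁)`, into `k × k`). [folklore] -/
theorem card_filter_trace_le (r : k) (hr : r * r = 1) :
    (Finset.univ.filter fun t : Matrix.SpecialLinearGroup (Fin 2) k =>
      Matrix.trace (t : Matrix (Fin 2) (Fin 2) k) = r + r).card ≤ Fintype.card k ^ 2 := by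
  rw [sq, ← Fintype.card_prod, ← Finset.card_univ]
  refine Finset.card_le_card_of_injOn (fun t : Matrix.SpecialLinearGroup (Fin 2) k =>
    if (t : Matrix (Fin 2) (Fin 2) k) 0 1 = 0 then ((t : Matrix (Fin 2) (Fin 2) k) 1 0, (0 : k))
    else ((t : Matrix (Fin 2) (Fin 2) k) 0 0, (t : Matrix (Fin 2) (Fin 2) k) 0 1))
    (fun _ _ => Finset.mem_coe.2 (Finset.mem_univ _)) ?_
  intro t ht t' ht' h
  simp only [Finset.coe_filter, Finset.mem_univ, true_and, Set.mem_setOf_eq] at ht ht'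
  rw [Matrix.trace_fin_two] at ht ht'
  have hdet : (t : Matrix (Fin 2) (Fin 2) k) 0 0 * (t : Matrix (Fin 2) (Fin 2) k) 1 1 -
      (t : Matrix (Fin 2) (Fin 2) k) 0 1 * (t : Matrix (Fin 2) (Fin 2) k) 1 0 = 1 := by
    have h := t.2
    rw [Matrix.det_fin_two] at h
    exact h
  have hdet' : (t' : Matrix (Fin 2) (Fin 2) k) 0 0 * (t' : Matrix (Fin 2) (Fin 2) k) 1 1 -
      (t' : Matrix (Fin 2) (Fin 2) k) 0 1 * (t' : Matrix (Fin 2) (Fin 2) k) 1 0 = 1 := by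
    have h := t'.2
    rw [Matrix.det_fin_two] at h
    exact h
  -- a double root: `b = 0 ⇒ a = r ∧ d = r`
  have hroot : ∀ u : Matrix.SpecialLinearGroup (Fin 2) k,
      (u : Matrix (Fin 2) (Fin 2) k) 0 0 + (u : Matrix (Fin 2) (Fin 2) k) 1 1 = r + r →
      (u : Matrix (Fin 2) (Fin 2) k) 0 0 * (u : Matrix (Fin 2) (Fin 2) k) 1 1 -
        (u : Matrix (Fin 2) (Fin 2) k) 0 1 * (u : Matrix (Fin 2) (Fin 2) k) 1 0 = 1 →
      (u : Matrix (Fin 2) (Fin 2) k) 0 1 = 0 →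
      (u : Matrix (Fin 2) (Fin 2) k) 0 0 = r ∧ (u : Matrix (Fin 2) (Fin 2) k) 1 1 = r := by
    intro u hu hdu hb
    have ha : ((u : Matrix (Fin 2) (Fin 2) k) 0 0 - r) ^ 2 = 0 := by
      linear_combination ((u : Matrix (Fin 2) (Fin 2) k) 0 0) * hu - hdu + hr -
        ((u : Matrix (Fin 2) (Fin 2) k) 1 0) * hb
    have ha' : (u : Matrix (Fin 2) (Fin 2) k) 0 0 = r :=
      sub_eq_zero.1 (pow_eq_zero_iff two_ne_zero |>.1 ha)
    exact ⟨ha', by linear_combination hu - ha'⟩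
  beta_reduce at h
  by_cases hb : (t : Matrix (Fin 2) (Fin 2) k) 0 1 = 0 <;>
    by_cases hb' : (t' : Matrix (Fin 2) (Fin 2) k) 0 1 = 0
  · rw [if_pos hb, if_pos hb'] at h
    obtain ⟨h1, -⟩ := Prod.mk_inj.1 h
    obtain ⟨ha, hd⟩ := hroot t ht hdet hb
    obtain ⟨ha', hd'⟩ := hroot t' ht' hdet' hb'
    apply Subtype.ext
    ext i j
    fin_cases i <;> fin_cases j
    · exact ha.trans ha'.symm
    · exact hb.trans hb'.symm
    · exact h1
    · exact hd.trans hd'.symm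
  · rw [if_pos hb, if_neg hb'] at h
    obtain ⟨-, h2⟩ := Prod.mk_inj.1 h
    exact absurd h2.symm hb'
  · rw [if_neg hb, if_pos hb'] at h
    obtain ⟨-, h2⟩ := Prod.mk_inj.1 h
    exact absurd h2 hb
  · rw [if_neg hb, if_neg hb'] at h
    obtain ⟨ha, hbb⟩ := Prod.mk_inj.1 h
    have hd : (t : Matrix (Fin 2) (Fin 2) k) 1 1 = (t' : Matrix (Fin 2) (Fin 2) k) 1 1 := by
      linear_combination ht - ht' - ha
    have hc : (t : Matrix (Fin 2) (Fin 2) k) 1 0 = (t' : Matrix (Fin 2) (Fin 2) k) 1 0 := by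
      have h0 : (t : Matrix (Fin 2) (Fin 2) k) 0 1 * ((t : Matrix (Fin 2) (Fin 2) k) 1 0 -
          (t' : Matrix (Fin 2) (Fin 2) k) 1 0) = 0 := by
        linear_combination hdet' - hdet + ((t' : Matrix (Fin 2) (Fin 2) k) 1 1) * ha +
          ((t : Matrix (Fin 2) (Fin 2) k) 0 0) * hd - ((t' : Matrix (Fin 2) (Fin 2) k) 1 0) * hbb
      exact sub_eq_zero.1 ((mul_eq_zero.1 h0).resolve_left hb)
    apply Subtype.ext
    ext i j
    fin_cases i <;> fin_cases j
    · exact ha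
    · exact hbb
    · exact hc
    · exact hd

end SLPart

end Summit.MatrixMultiplication.MatrixMultiplication.Theorems.GradedDesignFamily.Negative
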